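import Mathlib
import HarnessLib
import Summits.ResolutionOfSingularities.ResolutionOfSingularities.Theorems.WildQuotientsWildQuotientResolutionS1aKillCertCover
import Summits.ResolutionOfSingularities.ResolutionOfSingularities.Theorems.WildQuotientsWildQuotientResolutionS1aNodeAway

/-!
# S1a — R4e auxiliaries for the assembly of `graphTail_killsIn_two` (polynomial identity of the recentred tail, iterates, restriction/pull-back identities)

[OURS · L1 W4.5c · lead-1 g17; plan-1 RULING R-F15s ★ R4e-rational `graphTail_killsIn_two` — small bookkeeping lemmas split off the assembly file to respect the
400-line rule] — NOT statements of the manuscript; counted 0; AI-level work, weaker than expert review. Crux stmt-ResolutionOfSingularities-17941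
`CyclicQuotientFourfolds`, line `s1a-logminvertex` v13 (`stub_reachLowerInFX`).

* `GraphTail.recentre_symm_localTail` — `γᵢ⁻¹(x₂ − x₁^{mᵢ+1}wᵢ(x₁)) = x₂ − g(x₁)` for the recentring `γᵢ⁻¹: x₁ ↦ x₁ − αᵢ, x₂ ↦ x₂ − g(αᵢ)` and the local factorisation;
* `GraphTail.dvd_prod_iterate_pow` — `t ∣ (∏_{j : ZMod p} σʲ t)ⁿ` for `0 < n`;
* `NodeAway.iterate_sigmaAway_algebraMap` — `τʲ (a/1) = (σʲ a)/1`;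
* `GameFrame.GModel.iterate_eq_self_of_chart` — `σᵖ = id` on the polynomial chart of a `G`-stable affine open when `g₀ᵖ = 1`;
* `appLE_map_apply`, `map_appLE_apply` — pointwise forms of Mathlib's `Scheme.Hom.appLE_map` / `map_appLE`.
-/

set_option linter.dupNamespace false

noncomputable section

open CategoryTheory Limits AlgebraicGeometry TopologicalSpace Topology Opposite MvPolynomial
open Literature.AlgebraicGeometry.Resolution Literature.AlgebraicGeometry.RelativeSpec
open Summit.ResolutionOfSingularities.ResolutionOfSingularities.Theorems.WildQuotientResolution.S1
open Summit.ResolutionOfSingularities.ResolutionOfSingularities.Theorems.WildQuotientResolution.S1.GoodCharts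

namespace Summit.ResolutionOfSingularities.ResolutionOfSingularities.Theorems.WildQuotientResolution.S1.GraphTail

variable {k : Type} [Field k]

/-- **The recentred local tail is the global tail**: with `γ⁻¹ x₁ = x₁ − α`, `γ⁻¹ x₂ = x₂ − g(α)` and `g(X+α) − g(α) = X^{m+1}·w`,
`γ⁻¹ (x₂ − x₁^{m+1}·w(x₁)) = x₂ − g(x₁)`. [OURS · L1 W4.5c · R4e; folklore] -/
theorem recentre_symm_localTail (γ : MvPolynomial (Fin 4) k ≃ₐ[k] MvPolynomial (Fin 4) k) (g : Polynomial k) (a : k) (m : ℕ) (w : Polynomial k)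
    (hγs1 : γ.symm (X 1) = X 1 - C a) (hγs2 : γ.symm (X 2) = X 2 - C (g.eval a))
    (hw : g.comp (Polynomial.X + Polynomial.C a) - Polynomial.C (g.eval a) = Polynomial.X ^ (m + 1) * w) :
    γ.symm (X 2 - X 1 ^ (m + 1) * Polynomial.aeval (X 1 : MvPolynomial (Fin 4) k) w : MvPolynomial (Fin 4) k) =
      X 2 - Polynomial.aeval (X 1 : MvPolynomial (Fin 4) k) g := by
  have hw' := congrArg (Polynomial.aeval (X 1 - C a : MvPolynomial (Fin 4) k)) hw
  simp only [map_sub, map_add, map_mul, map_pow, Polynomial.aeval_comp, Polynomial.aeval_X, Polynomial.aeval_C, MvPolynomial.algebraMap_eq,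
    sub_add_cancel] at hw'
  have haw : γ.symm (Polynomial.aeval (X 1 : MvPolynomial (Fin 4) k) w) = Polynomial.aeval (γ.symm (X 1)) w :=
    (Polynomial.aeval_algHom_apply (γ.symm : MvPolynomial (Fin 4) k →ₐ[k] MvPolynomial (Fin 4) k) (X 1) w).symm
  rw [map_sub, map_mul, map_pow, haw, hγs2, hγs1, ← hw']
  ring

/-- `t ∣ (∏_{j : ZMod p} σ^[j] t)ⁿ` for `0 < n` (the factor `j = 0`). [folklore] -/
theorem dvd_prod_iterate_pow {R : Type*} [CommMonoid R] {p : ℕ} [NeZero p] (σ : R → R) (t : R) {n : ℕ} (hn : 0 < n) :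
    t ∣ (∏ j : ZMod p, σ^[j.val] t) ^ n := by
  refine dvd_trans ?_ (dvd_pow_self _ hn.ne')
  have h := Finset.dvd_prod_of_mem (fun j : ZMod p => σ^[j.val] t) (Finset.mem_univ (0 : ZMod p))
  rwa [ZMod.val_zero, Function.iterate_zero_apply] at h

end Summit.ResolutionOfSingularities.ResolutionOfSingularities.Theorems.WildQuotientResolution.S1.GraphTail

namespace Summit.ResolutionOfSingularities.ResolutionOfSingularities.Theorems.WildQuotientResolution.S1.NodeAway

/-- Iterates of `sigmaAway` on elements of the base: `τʲ (a/1) = (σʲ a)/1`. [folklore] -/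
theorem iterate_sigmaAway_algebraMap {B : Type*} [CommRing B] (σ : B ≃+* B) (h : B) (hσh : σ h = h) (j : ℕ) (a : B) :
    (⇑(sigmaAway σ hσh))^[j] (algebraMap B (Localization.Away h) a) = algebraMap B (Localization.Away h) ((⇑σ)^[j] a) := by
  induction j generalizing a with
  | zero => rfl
  | succ j ih => rw [Function.iterate_succ_apply', ih, sigmaAway_algebraMap, Function.iterate_succ_apply']

end Summit.ResolutionOfSingularities.ResolutionOfSingularities.Theorems.WildQuotientResolution.S1.NodeAway

namespace Summit.ResolutionOfSingularities.ResolutionOfSingularities.Theorems.WildQuotientResolution.S1.GameFrame.GModel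

variable {p : ℕ} {X' X₁ : Scheme.{0}} {q : X' ⟶ X₁} {G : Type} [Group G] {ρ : G →* Aut X'} {g₀ : G}

/-- **`σᵖ = id` on the coordinate ring of a polynomial chart** of a `G`-stable affine open, when `g₀ᵖ = 1`. [OURS · L1 W4.5c; folklore] -/
theorem iterate_eq_self_of_chart (M : GModel p q G ρ g₀) (O : M.act.StableAffineOpens) (hg₀ : g₀ ^ p = 1)
    {K : Type} [CommRing K] (e : Γ(M.V, O.1) ≃+* K) (σ : K ≃+* K) (hact : ∀ t : Γ(M.V, O.1), actOEquiv M.act O g₀ t = e.symm (σ (e t))) (a : K) :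
    (⇑σ)^[p] a = a := by
  have key : ∀ (n : ℕ) (a : K), (⇑σ)^[n] a = e ((⇑(actOEquiv M.act O g₀))^[n] (e.symm a)) := by
    intro n
    induction n with
    | zero => intro a; rw [Function.iterate_zero_apply, Function.iterate_zero_apply, e.apply_symm_apply]
    | succ n ih => intro a; rw [Function.iterate_succ_apply', ih, Function.iterate_succ_apply', hact, e.apply_symm_apply]
  rw [key, actOEquiv_iterate_eq_self M.act O hg₀, e.apply_symm_apply]

end Summit.ResolutionOfSingularities.ResolutionOfSingularities.Theorems.WildQuotientResolution.S1.GameFrame.GModel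

namespace AlgebraicGeometry.Scheme.Hom

/-- Pointwise `appLE_map`: restricting a pulled-back section is pulling back to the smaller open. [folklore] -/
theorem appLE_map_apply {X Y : Scheme} (f : X ⟶ Y) {U : Y.Opens} {V V' : X.Opens} (e : V ≤ f ⁻¹ᵁ U) (h : V' ≤ V) (s : Γ(Y, U)) :
    (X.presheaf.map (homOfLE h).op).hom (f.appLE U V e s) = f.appLE U V' (h.trans e) s := by
  have h' := congrArg (fun ψ => ψ.hom s) (Scheme.Hom.appLE_map f e (homOfLE h).op)
  rw [CommRingCat.hom_comp, RingHom.comp_apply] at h'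
  exact h'

/-- Pointwise `map_appLE`: pulling back a restricted section is pulling back the section. [folklore] -/
theorem map_appLE_apply {X Y : Scheme} (f : X ⟶ Y) {U U' : Y.Opens} {V : X.Opens} (e : V ≤ f ⁻¹ᵁ U) (h : U ≤ U') (e' : V ≤ f ⁻¹ᵁ U') (s : Γ(Y, U')) :
    f.appLE U V e ((Y.presheaf.map (homOfLE h).op).hom s) = f.appLE U' V e' s := by
  have h' := congrArg (fun ψ => ψ.hom s) (Scheme.Hom.map_appLE f e (homOfLE h).op)
  rw [CommRingCat.hom_comp, RingHom.comp_apply] at h'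
  exact h'

end AlgebraicGeometry.Scheme.Hom

end
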